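import Literature.NumberTheory.Transcendental.GammaLocusSlices
import Literature.FieldTheory.Regular.RegularBaseChange
import Literature.RingTheory.KrullDimension.FieldOfDefinition
import Mathlib.Analysis.Complex.Cardinality
import Mathlib.FieldTheory.IsAlgClosed.Basic
import Mathlib.FieldTheory.AlgebraicClosure
import Mathlib.RingTheory.AlgebraicIndependent.Adjoin
import Mathlib.RingTheory.AlgebraicIndependent.AlgebraicClosure
import Mathlib.RingTheory.AlgebraicIndependent.TranscendenceBasis
import Mathlib.RingTheory.Algebraic.Cardinality
import Mathlib.SetTheory.Cardinal.Subfield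
import Mathlib.Analysis.Complex.Polynomial.Basic
import Literature.NumberTheory.Transcendental.WeakZPStar
import Literature.NumberTheory.Transcendental.ZilberProp115
import HarnessLib

/-!
# Bays–Kirby 2018, Prop. 11.5 holds: the weak Zilber–Pink bound over every algebraically closed
field of characteristic zero (Lefschetz transfer from `ℂ`), and the discharge of the named fact

This file proves `Literature.NumberTheory.Transcendental.BaysKirby2018_prop_11_5_holds`, the
discharge of the named fact `Literature.NumberTheory.Transcendental.BaysKirby2018_prop_11_5`
(M. Bays, J. Kirby, *Pseudo-exponential maps, variants, and quasiminimality*, Algebra & Number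
Theory 12 (2018) 493–549, Prop. 11.5: for a full Γ-field `F` and `K ◁_cl F`, generic
Γ-closedness over `K` implies generic strong Γ-closedness over `K`; `ZilberGenericClosedness.lean`).

The tree already contains the two halves of Bays–Kirby's proof:

* `Literature.NumberTheory.Transcendental.BaysKirby2018_prop_11_5_of_weakZP`
  (`ZilberProp115.lean`): Prop. 11.5 follows from its deep input, the horizontal semiabelian weak
  Zilber–Pink theorem (Thm 11.4) for `S = 𝔾ₘᴺ`, `U = 𝔾ₐᴺ` and the linear slices of a Zariski
  closed `W`, in the form "for every algebraically closed `F` of characteristic zero, every `N` and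
  every closed `W ⊆ F^{N ⊕ N}` there is a finite set `𝓗` of integer matrices with
  `Literature.NumberTheory.Transcendental.WeakZPBound F N W 𝓗`";
* `Literature.NumberTheory.Transcendental.WeakZP.weakZPBound_complex` (`WeakZPStar.lean`): this
  bound over `F = ℂ` (Ax's theorem + compactness, Zilber 2002 / Kirby 2009, Thm 4.6, and
  Bays–Kirby's induction for the clause `(*)`).

What remains, and is done here, is the passage from `ℂ` to an arbitrary algebraically closed field
of characteristic zero in an arbitrary universe (`weakZPBound_of_isAlgClosed`) — a
Lefschetz-principle argument carried out algebraically: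

1. **Base change of `G`-closed sets between algebraically closed fields** (namespace
   `WeakZPTransfer`; Lang, *Algebra* VIII §4; Görtz–Wedhorn I, Prop. 5.38). For an extension
   `k → Ω` of algebraically closed fields of characteristic zero and ideals `J ⊆ k[X, Y]`
   evaluated at `Ω`-points (Mathlib's two-field `MvPolynomial.zeroLocus Ω J`):
   primes of `k[X]` extend to primes of `Ω[X]` (`WeakZPTransfer.isPrime_map_of_isAlgClosed`, via
   the tree's `Literature.FieldTheory.Regular.isPrime_map_ker_aeval`); the minimal primes of
   `J Ω[X]` are the extensions of those of `J` (`WeakZPTransfer.minimalPrimes_map_eq`);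
   `dim Ω[X] ⧸ P Ω[X] = dim k[X] ⧸ P` (`WeakZPTransfer.ringKrullDim_quotient_map_eq_of_isAlgClosed`);
   the dimension of the torus part `Z(I) ∩ Gᴺ` of a closed set is the maximum of `dim Ω[X] ⧸ Q`
   over the minimal primes `Q ∌ ∏ Yᵢ` of `I`
   (`WeakZPTransfer.zariskiDim_zeroLocus_inter_torusLocus_le_iff`), whence
   `dim_Ω (Z_Ω(J) ∩ Gᴺ) = dim_k (Z_k(J) ∩ Gᴺ)` (`WeakZPTransfer.zariskiDim_baseChange_inter_torusLocus`);
   `Z_Ω(P) ∩ Gᴺ` is irreducible in `Gᴺ` for `P` prime with `∏ Yᵢ ∉ P`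
   (`WeakZPTransfer.isIrreducibleInG_baseChange`); and a polynomial over `k` vanishes on
   `Z_Ω(P) ∩ Gᴺ` iff it lies in `P` (`WeakZPTransfer.forall_aeval_eq_zero_iff_mem`).
2. **Slices and cosets with data over `k`** are torus parts of zero sets of explicit polynomials
   over `k` (`WeakZPTransfer.sliceSet`, `WeakZPTransfer.instSet`,
   `WeakZPTransfer.zeroLocus_instSet_inter_torusLocus`), so that all quantities in `WeakZPBound`
   are invariant under the extension, and the bound **descends** from `Ω` to `k` for irreducible
   subvarieties of slice–coset intersections (`WeakZPTransfer.weakZPBound_descend`; an irreducible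
   atypical `X` over `k` extends to an irreducible atypical subvariety over `Ω`, contained in an
   atypical component, `Literature.NumberTheory.Transcendental.exists_isIrredComponentInG_superset`).
3. **Embeddings into `ℂ`** (Steinitz): algebraically independent complex numbers exist over every
   countable subfield (`WeakZPTransfer.exists_algebraicIndependent_complex`, by cardinality), so a
   field algebraic over `L₀(b)`, `b` finite algebraically independent, `L₀` countable, embeds into
   `ℂ` over any embedding of `L₀` (`WeakZPTransfer.exists_ringHom_comp_algebraMap_eq`, with
   `IsAlgClosed.lift`); inside an algebraically closed `F`, the relative algebraic closure
   `WeakZPTransfer.defField L₀ S` of `L₀(S)` (`S` finite) is a countable algebraically closed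
   subfield embedding into `ℂ` over `L₀` (`WeakZPTransfer.exists_defField_ringHom`).
4. **The transfer** (`weakZPBound_of_isAlgClosed`): `W = Z_F(G₁)` with `G₁` over the field of
   definition `K₁` of generators of `I(W)`; `σ₀ : K₁ → ℂ` gives `W_ℂ = Z_ℂ(G₁^{σ₀})` and
   `𝓗 := 𝓗(W_ℂ)`. An instance `(A, κ, M_J, c, X, x)` of the bound over `F` is defined over
   `K₂ = defField K₁ (data ∪ coefficients of generators of I(X̄))`, `σ₀` extends to
   `σ₂ : K₂ → ℂ`, `X = Z_F(P₂) ∩ Gᴺ` for a prime `P₂ ⊆ K₂[X]`; the instance descends to `K₂`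
   (invariance under `K₂ ⊆ F`), the bound holds over `K₂` by descent from `ℂ` along `σ₂`, and the
   conclusion ascends back to `F`.

Finally `BaysKirby2018_prop_11_5_holds := BaysKirby2018_prop_11_5_of_weakZP weakZPBound_of_isAlgClosed`.

## References

* M. Bays, J. Kirby, *Pseudo-exponential maps, variants, and quasiminimality*, Algebra & Number
  Theory 12 (2018) 493–549, Thm 11.4, Prop. 11.5.
* J. Kirby, *The theory of the exponential differential equations of semiabelian varieties*,
  Selecta Math. 15 (2009) 445–486, Thm 4.6.
* S. Lang, *Algebra*, GTM 211, VIII §4 (regular extensions).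
* U. Görtz, T. Wedhorn, *Algebraic Geometry I*, 2nd ed. (2020), Prop. 5.38.
* E. Steinitz, *Algebraische Theorie der Körper*, J. reine angew. Math. 137 (1910), §§22–24.
-/

noncomputable section

universe u

open Set MvPolynomial

namespace Literature.NumberTheory.Transcendental.WeakZPTransfer

/-! ### Primes of `k[X]` extend to primes of `Ω[X]` when `k` is algebraically closed -/

section Primes

variable {k : Type*} {Ω : Type*} [Field k] [CharZero k] [IsAlgClosed k] [Field Ω] [Algebra k Ω]
  {ι : Type*}

omit [CharZero k] in
/-- An element of an extension of an algebraically closed field `k` which is algebraic over `k`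
lies in `k`. [folklore] -/
theorem mem_range_algebraMap_of_isAlgebraic {K : Type*} [Field K] [Algebra k K] {z : K}
    (hz : IsAlgebraic k z) : z ∈ Set.range (algebraMap k K) := by
  have hdeg := IsAlgClosed.degree_eq_one_of_irreducible k (minpoly.irreducible hz.isIntegral)
  have := minpoly.mem_range_of_degree_eq_one k z hdeg
  rwa [RingHom.mem_range] at this

/-- The coordinate classes in the fraction field of `k[X] ⧸ P`: the generic point of `P`.
[folklore] -/
def genPt (P : Ideal (MvPolynomial ι k)) [P.IsPrime] : ι → FractionRing (MvPolynomial ι k ⧸ P) :=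
  fun j => algebraMap (MvPolynomial ι k ⧸ P) (FractionRing (MvPolynomial ι k ⧸ P))
    (Ideal.Quotient.mk P (X j))

omit [CharZero k] [IsAlgClosed k] in
/-- `P` is the kernel of evaluation at its generic point. [folklore] -/
theorem ker_aeval_genPt (P : Ideal (MvPolynomial ι k)) [P.IsPrime] :
    RingHom.ker (aeval (genPt P) : MvPolynomial ι k →ₐ[k] FractionRing (MvPolynomial ι k ⧸ P)) = P := by
  have h : (aeval (genPt P) : MvPolynomial ι k →ₐ[k] FractionRing (MvPolynomial ι k ⧸ P)) =
      (IsScalarTower.toAlgHom k (MvPolynomial ι k ⧸ P) (FractionRing (MvPolynomial ι k ⧸ P))).comp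
        (Ideal.Quotient.mkₐ k P) :=
    MvPolynomial.algHom_ext fun j => by simp [genPt]
  ext p
  rw [RingHom.mem_ker, h, AlgHom.comp_apply, IsScalarTower.coe_toAlgHom', Ideal.Quotient.mkₐ_eq_mk,
    map_eq_zero_iff _ (IsFractionRing.injective (MvPolynomial ι k ⧸ P) _),
    Ideal.Quotient.eq_zero_iff_mem]

/-- **Primes extend to primes.** For `k` algebraically closed of characteristic zero, `P` a
prime of `k[X]` and any field extension `Ω` of `k`, the extended ideal `P Ω[X]` is prime (`k` is
relatively algebraically closed in the function field of `P`; Lang VIII §4).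
[cite: Lang2002, VIII §4] -/
theorem isPrime_map_of_isAlgClosed (P : Ideal (MvPolynomial ι k)) [P.IsPrime] :
    (P.map (MvPolynomial.map (algebraMap k Ω))).IsPrime := by
  have h := Literature.FieldTheory.Regular.isPrime_map_ker_aeval (algebraMap k Ω) (genPt P)
    (fun z hz => mem_range_algebraMap_of_isAlgebraic hz)
  rwa [ker_aeval_genPt] at h

omit [CharZero k] [IsAlgClosed k] in
/-- **`J Ω[X] ∩ k[X] = J`** (faithful flatness). [folklore] -/
theorem comap_map_eq (J : Ideal (MvPolynomial ι k)) :
    (J.map (MvPolynomial.map (algebraMap k Ω))).comap (MvPolynomial.map (algebraMap k Ω)) = J := by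
  ext p
  rw [Ideal.mem_comap]
  exact Literature.FieldTheory.Regular.map_mem_map_iff J p

omit [CharZero k] [IsAlgClosed k] in
/-- Extension of ideals along `k[X] → Ω[X]` is injective. [folklore] -/
theorem map_injective {J J' : Ideal (MvPolynomial ι k)}
    (h : J.map (MvPolynomial.map (algebraMap k Ω)) = J'.map (MvPolynomial.map (algebraMap k Ω))) :
    J = J' := by
  rw [← comap_map_eq (Ω := Ω) J, h, comap_map_eq]

omit [CharZero k] [IsAlgClosed k] in
/-- Extension of ideals along `k[X] → Ω[X]` reflects the order. [folklore] -/
theorem le_of_map_le_map {J J' : Ideal (MvPolynomial ι k)}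
    (h : J.map (MvPolynomial.map (algebraMap k Ω)) ≤ J'.map (MvPolynomial.map (algebraMap k Ω))) :
    J ≤ J' := by
  rw [← comap_map_eq (Ω := Ω) J, ← comap_map_eq (Ω := Ω) J']
  exact Ideal.comap_mono h

omit [CharZero k] [IsAlgClosed k] in
/-- A prime of `Ω[X]` above `J Ω[X]` lies above the extension of a minimal prime of `J`.
[folklore] -/
theorem exists_minimalPrimes_map_le {J : Ideal (MvPolynomial ι k)} {Q : Ideal (MvPolynomial ι Ω)}
    [Q.IsPrime] (hQ : J.map (MvPolynomial.map (algebraMap k Ω)) ≤ Q) :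
    ∃ P ∈ J.minimalPrimes, P.map (MvPolynomial.map (algebraMap k Ω)) ≤ Q := by
  have h1 : J ≤ Q.comap (MvPolynomial.map (algebraMap k Ω)) := by
    rw [← comap_map_eq (Ω := Ω) J]; exact Ideal.comap_mono hQ
  obtain ⟨P, hP, hPle⟩ := Ideal.exists_minimalPrimes_le h1
  exact ⟨P, hP, (Ideal.map_mono hPle).trans Ideal.map_comap_le⟩

/-- **The minimal primes of `J Ω[X]` are the extensions of the minimal primes of `J`.**
[folklore] -/
theorem minimalPrimes_map_eq (J : Ideal (MvPolynomial ι k)) :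
    (J.map (MvPolynomial.map (algebraMap k Ω))).minimalPrimes =
      (fun P => P.map (MvPolynomial.map (algebraMap k Ω))) '' J.minimalPrimes := by
  ext Q
  constructor
  · intro hQ
    haveI : Q.IsPrime := hQ.1.1
    obtain ⟨P, hP, hPQ⟩ := exists_minimalPrimes_map_le hQ.1.2
    haveI : P.IsPrime := hP.1.1
    refine ⟨P, hP, le_antisymm hPQ (hQ.2 ⟨isPrime_map_of_isAlgClosed P, Ideal.map_mono hP.1.2⟩ hPQ)⟩
  · rintro ⟨P, hP, rfl⟩
    haveI : P.IsPrime := hP.1.1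
    refine ⟨⟨isPrime_map_of_isAlgClosed P, Ideal.map_mono hP.1.2⟩, ?_⟩
    rintro Q ⟨hQ, hJQ⟩ hQP
    haveI : Q.IsPrime := hQ
    obtain ⟨P', hP', hP'Q⟩ := exists_minimalPrimes_map_le hJQ
    -- `P' ≤ P`, hence `P' = P` by minimality
    have hP'P : P' ≤ P := le_of_map_le_map (hP'Q.trans hQP)
    haveI : P'.IsPrime := hP'.1.1
    have heq : P' = P := le_antisymm hP'P (hP.2 ⟨hP'.1.1, hP'.1.2⟩ hP'P)
    rw [heq] at hP'Q
    exact hP'Q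

variable [Finite ι]

/-- **Extension of an algebraically closed base field keeps the dimension of a prime**:
`dim Ω[X] ⧸ P Ω[X] = dim k[X] ⧸ P` (Görtz–Wedhorn I, Prop. 5.38). Chains of primes above `P`
extend to chains above `P Ω[X]` (`≥`); `≤` is
`Literature.RingTheory.KrullDimension.ringKrullDim_quotient_le_of_forall_map_mem`.
[cite: GortzWedhorn2020, Prop. 5.38] -/
theorem ringKrullDim_quotient_map_eq_of_isAlgClosed (P : Ideal (MvPolynomial ι k)) [P.IsPrime] :
    ringKrullDim (MvPolynomial ι Ω ⧸ P.map (MvPolynomial.map (algebraMap k Ω))) =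
      ringKrullDim (MvPolynomial ι k ⧸ P) := by
  refine le_antisymm
    (Literature.RingTheory.KrullDimension.ringKrullDim_quotient_le_of_forall_map_mem P _
      fun f hf => Ideal.mem_map_of_mem _ hf) ?_
  rw [ringKrullDim_quotient, ringKrullDim_quotient]
  -- extend chains of primes
  let f : PrimeSpectrum.zeroLocus (P : Set (MvPolynomial ι k)) →
      PrimeSpectrum.zeroLocus ((P.map (MvPolynomial.map (algebraMap k Ω)) : Ideal (MvPolynomial ι Ω)) :
        Set (MvPolynomial ι Ω)) :=
    fun p => ⟨⟨p.1.asIdeal.map (MvPolynomial.map (algebraMap k Ω)),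
        @isPrime_map_of_isAlgClosed k Ω _ _ _ _ _ ι p.1.asIdeal p.1.2⟩,
      fun x hx => Ideal.map_mono (fun y hy => p.2 hy) hx⟩
  refine Order.krullDim_le_of_strictMono f fun p q hpq => ?_
  have hle : p.1.asIdeal ≤ q.1.asIdeal := le_of_lt hpq
  have hne : p.1.asIdeal ≠ q.1.asIdeal := ne_of_lt hpq
  refine lt_of_le_of_ne (Ideal.map_mono hle) fun h => hne ?_
  have h' : p.1.asIdeal.map (MvPolynomial.map (algebraMap k Ω)) =
      q.1.asIdeal.map (MvPolynomial.map (algebraMap k Ω)) := congrArg (fun x => x.1.asIdeal) h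
  exact map_injective h'

end Primes

/-! ### The torus part of a closed set: vanishing ideal and dimension -/

section Torus

variable {Ω : Type*} [Field Ω] {N : ℕ}

/-- The monomial `∏ Yᵢ` cutting out the complement of the torus locus. [folklore] -/
def prodY (R : Type*) [CommSemiring R] (N : ℕ) : MvPolynomial (Fin N ⊕ Fin N) R := ∏ i, X (Sum.inr i)

/-- Evaluating `∏ Yᵢ`. [folklore] -/
theorem aeval_prodY {R : Type*} [CommRing R] [Algebra R Ω] (z : Fin N ⊕ Fin N → Ω) :
    aeval z (prodY R N) = ∏ i, z (Sum.inr i) := by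
  simp [prodY, map_prod]

/-- `∏ Yᵢ` does not vanish exactly on the torus locus. [folklore] -/
theorem aeval_prodY_ne_zero_iff {R : Type*} [CommRing R] [Algebra R Ω] (z : Fin N ⊕ Fin N → Ω) :
    aeval z (prodY R N) ≠ 0 ↔ z ∈ torusLocus Ω N := by
  rw [aeval_prodY, Finset.prod_ne_zero_iff, mem_torusLocus_iff]
  simp

/-- `∏ Yᵢ` is preserved by change of coefficients. [folklore] -/
theorem map_prodY {R S : Type*} [CommSemiring R] [CommSemiring S] (f : R →+* S) :
    MvPolynomial.map f (prodY R N) = prodY S N := by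
  simp [prodY, map_prod]

/-- **`I(C ∩ Gᴺ) = (I(C) : ∏ Yᵢ)`**: a polynomial vanishes on the torus part of `C` iff its product
with `∏ Yᵢ` vanishes on `C`. [folklore] -/
theorem mem_vanishingIdeal_inter_torusLocus_iff (C : Set (Fin N ⊕ Fin N → Ω))
    (f : MvPolynomial (Fin N ⊕ Fin N) Ω) :
    f ∈ vanishingIdeal Ω (C ∩ torusLocus Ω N) ↔ f * prodY Ω N ∈ vanishingIdeal Ω C := by
  simp only [mem_vanishingIdeal_iff, map_mul]
  constructor
  · intro h z hz
    by_cases hzT : z ∈ torusLocus Ω N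
    · rw [h z ⟨hz, hzT⟩, zero_mul]
    · have : aeval z (prodY Ω N) = 0 := by
        by_contra h0; exact hzT ((aeval_prodY_ne_zero_iff z).1 h0)
      rw [this, mul_zero]
  · rintro h z ⟨hz, hzT⟩
    have h1 := h z hz
    rcases mul_eq_zero.1 h1 with h2 | h2
    · exact h2
    · exact absurd h2 ((aeval_prodY_ne_zero_iff z).2 hzT)

variable [IsAlgClosed Ω]

/-- Over an algebraically closed field, a polynomial vanishes on `Z(I) ∩ Gᴺ` iff it lies in every
minimal prime of `I` not containing `∏ Yᵢ`. [folklore] -/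
theorem mem_vanishingIdeal_zeroLocus_inter_torusLocus_iff (I : Ideal (MvPolynomial (Fin N ⊕ Fin N) Ω))
    (f : MvPolynomial (Fin N ⊕ Fin N) Ω) :
    f ∈ vanishingIdeal Ω (zeroLocus Ω I ∩ torusLocus Ω N) ↔
      ∀ Q ∈ I.minimalPrimes, prodY Ω N ∉ Q → f ∈ Q := by
  rw [mem_vanishingIdeal_inter_torusLocus_iff, vanishingIdeal_zeroLocus_eq_radical,
    ← Ideal.sInf_minimalPrimes, Ideal.mem_sInf]
  constructor
  · intro h Q hQ hY
    exact ((hQ.1.1).mem_or_mem (h hQ)).resolve_right hY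
  · intro h Q hQ
    by_cases hY : prodY Ω N ∈ Q
    · exact Ideal.mul_mem_left Q f hY
    · exact Ideal.mul_mem_right _ Q (h Q hQ hY)

/-- `dim R ⧸ I ≤ n` as soon as `dim R ⧸ 𝔮 ≤ n` for every minimal prime `𝔮` of `I` (any bound
`n`; cf. `Literature.NumberTheory.Transcendental.ringKrullDim_quotient_le_of_minimalPrimes` for
natural `n`). [folklore] -/
theorem ringKrullDim_quotient_le_of_minimalPrimes' {R : Type*} [CommRing R] (I : Ideal R)
    (n : WithBot ℕ∞) (h : ∀ 𝔮 ∈ I.minimalPrimes, ringKrullDim (R ⧸ 𝔮) ≤ n) :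
    ringKrullDim (R ⧸ I) ≤ n := by
  rw [ringKrullDim_quotient]
  refine iSup_le fun l => ?_
  have h0 : I ≤ (l 0).1.asIdeal := (l 0).2
  obtain ⟨𝔮, h𝔮, h𝔮le⟩ := Ideal.exists_minimalPrimes_le h0
  have hmem : ∀ i, (l i).1 ∈ PrimeSpectrum.zeroLocus (𝔮 : Set R) := by
    intro i x hx
    exact (l.monotone (Fin.zero_le _) : (l 0).1 ≤ (l i).1) (h𝔮le hx)
  let l' : LTSeries (PrimeSpectrum.zeroLocus (𝔮 : Set R)) :=
    ⟨l.length, fun i => ⟨(l i).1, hmem i⟩, fun i => l.step i⟩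
  have h1 : (l'.length : WithBot ℕ∞) ≤ Order.krullDim (PrimeSpectrum.zeroLocus (𝔮 : Set R)) :=
    Order.LTSeries.length_le_krullDim l'
  rw [← ringKrullDim_quotient] at h1
  exact h1.trans (h 𝔮 h𝔮)

/-- **Dimension of the torus part of a closed set**: `dim (Z(I) ∩ Gᴺ) ≤ n` iff
`dim Ω[X] ⧸ Q ≤ n` for every minimal prime `Q` of `I` with `∏ Yᵢ ∉ Q` (the closure of
`Z(I) ∩ Gᴺ` is the union of the components of `Z(I)` meeting `Gᴺ`). [folklore] -/
theorem zariskiDim_zeroLocus_inter_torusLocus_le_iff (I : Ideal (MvPolynomial (Fin N ⊕ Fin N) Ω))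
    (n : WithBot ℕ∞) :
    zariskiDim Ω (zeroLocus Ω I ∩ torusLocus Ω N) ≤ n ↔
      ∀ Q ∈ I.minimalPrimes, prodY Ω N ∉ Q → ringKrullDim (MvPolynomial (Fin N ⊕ Fin N) Ω ⧸ Q) ≤ n := by
  classical
  set V := vanishingIdeal Ω (zeroLocus Ω I ∩ torusLocus Ω N) with hV
  have hVle : ∀ Q ∈ I.minimalPrimes, prodY Ω N ∉ Q → V ≤ Q := fun Q hQ hY f hf =>
    (mem_vanishingIdeal_zeroLocus_inter_torusLocus_iff I f).1 hf Q hQ hY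
  constructor
  · intro h Q hQ hY
    refine le_trans ?_ h
    unfold zariskiDim
    exact ringKrullDim_le_of_surjective (Ideal.Quotient.factor (hVle Q hQ hY))
      (Ideal.Quotient.factor_surjective (hVle Q hQ hY))
  · intro h
    unfold zariskiDim
    refine ringKrullDim_quotient_le_of_minimalPrimes' V n fun 𝔮 h𝔮 => ?_
    haveI : 𝔮.IsPrime := h𝔮.1.1
    -- `𝔮 ⊇ V = ⋂ {Q minimal over I, ∏ Y ∉ Q}`, so `𝔮` contains, hence equals, such a `Q`
    set G : Set (Ideal (MvPolynomial (Fin N ⊕ Fin N) Ω)) :=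
      {Q | Q ∈ I.minimalPrimes ∧ prodY Ω N ∉ Q} with hG
    have hGfin : G.Finite :=
      (Ideal.finite_minimalPrimes_of_isNoetherianRing _ I).subset fun Q hQ => hQ.1
    have hVeq : V = hGfin.toFinset.inf id := by
      refine le_antisymm ?_ ?_
      · refine Finset.le_inf fun Q hQ => ?_
        rw [Set.Finite.mem_toFinset] at hQ
        exact hVle Q hQ.1 hQ.2
      · intro f hf
        rw [hV, mem_vanishingIdeal_zeroLocus_inter_torusLocus_iff]
        intro Q hQ hY
        have : hGfin.toFinset.inf id ≤ Q :=
          Finset.inf_le (by rw [Set.Finite.mem_toFinset]; exact ⟨hQ, hY⟩)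
        exact this hf
    have h1 : hGfin.toFinset.inf id ≤ 𝔮 := by rw [← hVeq]; exact h𝔮.1.2
    obtain ⟨Q, hQG, hQ𝔮⟩ := (Ideal.IsPrime.inf_le' inferInstance).1 h1
    rw [Set.Finite.mem_toFinset] at hQG
    haveI : Q.IsPrime := hQG.1.1.1
    have hVQ : V ≤ Q := hVle Q hQG.1 hQG.2
    have heq : 𝔮 = Q := le_antisymm (h𝔮.2 ⟨hQG.1.1.1, hVQ⟩ hQ𝔮) hQ𝔮
    rw [heq]
    exact h Q hQG.1 hQG.2

/-- The vanishing ideal of `Z(P) ∩ Gᴺ` for a prime `P ∌ ∏ Yᵢ` is `P`. [folklore] -/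
theorem vanishingIdeal_zeroLocus_inter_torusLocus_of_isPrime
    (P : Ideal (MvPolynomial (Fin N ⊕ Fin N) Ω)) [P.IsPrime] (hY : prodY Ω N ∉ P) :
    vanishingIdeal Ω (zeroLocus Ω P ∩ torusLocus Ω N) = P := by
  ext f
  rw [mem_vanishingIdeal_inter_torusLocus_iff, IsPrime.vanishingIdeal_zeroLocus P]
  constructor
  · intro h; exact ((inferInstance : P.IsPrime).mem_or_mem h).resolve_right hY
  · intro h; exact P.mul_mem_right _ h

/-- `Z(P) ∩ Gᴺ` is non-empty for a prime `P ∌ ∏ Yᵢ`. [folklore] -/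
theorem zeroLocus_inter_torusLocus_nonempty_of_isPrime
    (P : Ideal (MvPolynomial (Fin N ⊕ Fin N) Ω)) [P.IsPrime] (hY : prodY Ω N ∉ P) :
    (zeroLocus Ω P ∩ torusLocus Ω N).Nonempty := by
  by_contra h
  rw [Set.not_nonempty_iff_eq_empty] at h
  have := vanishingIdeal_zeroLocus_inter_torusLocus_of_isPrime P hY
  rw [h, vanishingIdeal_empty] at this
  exact hY (this ▸ Submodule.mem_top)

end Torus

/-! ### Base change from `k` to `Ω`: dimension, irreducibility, containment, rational points -/

section BaseChange

variable {k : Type*} {Ω : Type*} [Field k] [CharZero k] [IsAlgClosed k] [Field Ω] [IsAlgClosed Ω]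
  [Algebra k Ω] {N : ℕ}

omit [CharZero k] [IsAlgClosed k] [IsAlgClosed Ω] in
/-- The two-field zero set of `J ⊆ k[X]` in `Ω` is the zero set of `J Ω[X]`. [folklore] -/
theorem zeroLocus_eq_zeroLocus_map (J : Ideal (MvPolynomial (Fin N ⊕ Fin N) k)) :
    zeroLocus Ω J = zeroLocus Ω (J.map (MvPolynomial.map (algebraMap k Ω))) :=
  (Literature.RingTheory.KrullDimension.zeroLocus_map J).symm

omit [CharZero k] [IsAlgClosed k] [IsAlgClosed Ω] in
/-- `∏ Yᵢ ∈ P Ω[X]` iff `∏ Yᵢ ∈ P`. [folklore] -/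
theorem prodY_mem_map_iff (P : Ideal (MvPolynomial (Fin N ⊕ Fin N) k)) :
    prodY Ω N ∈ P.map (MvPolynomial.map (algebraMap k Ω)) ↔ prodY k N ∈ P := by
  rw [← map_prodY (algebraMap k Ω)]
  exact Literature.FieldTheory.Regular.map_mem_map_iff P _

/-- **The dimension of the torus part of a `k`-closed set does not change under extension of the
algebraically closed base field**: `dim_Ω (Z_Ω(J) ∩ Gᴺ) = dim_k (Z_k(J) ∩ Gᴺ)`.
[cite: GortzWedhorn2020, Prop. 5.38] -/
theorem zariskiDim_baseChange_inter_torusLocus (J : Ideal (MvPolynomial (Fin N ⊕ Fin N) k)) :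
    zariskiDim Ω (zeroLocus Ω J ∩ torusLocus Ω N) = zariskiDim k (zeroLocus k J ∩ torusLocus k N) := by
  have key : ∀ n : WithBot ℕ∞, zariskiDim Ω (zeroLocus Ω J ∩ torusLocus Ω N) ≤ n ↔
      zariskiDim k (zeroLocus k J ∩ torusLocus k N) ≤ n := by
    intro n
    rw [zeroLocus_eq_zeroLocus_map J, zariskiDim_zeroLocus_inter_torusLocus_le_iff,
      zariskiDim_zeroLocus_inter_torusLocus_le_iff, minimalPrimes_map_eq]
    constructor
    · intro h P hP hY
      haveI : P.IsPrime := hP.1.1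
      rw [← ringKrullDim_quotient_map_eq_of_isAlgClosed (Ω := Ω) P]
      exact h _ ⟨P, hP, rfl⟩ (by rwa [prodY_mem_map_iff])
    · rintro h _ ⟨P, hP, rfl⟩ hY
      haveI : P.IsPrime := hP.1.1
      rw [ringKrullDim_quotient_map_eq_of_isAlgClosed (Ω := Ω) P]
      exact h P hP (by rwa [prodY_mem_map_iff] at hY)
  exact le_antisymm ((key _).2 le_rfl) ((key _).1 le_rfl)

/-- **`Z_Ω(P) ∩ Gᴺ` is irreducible in `Gᴺ`** for a prime `P ⊆ k[X]` not containing `∏ Yᵢ`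
(its closure `Z_Ω(P) = Z(P Ω[X])` has prime vanishing ideal `P Ω[X]`). [cite: Lang2002, VIII §4] -/
theorem isIrreducibleInG_baseChange (P : Ideal (MvPolynomial (Fin N ⊕ Fin N) k)) [P.IsPrime]
    (hY : prodY k N ∉ P) : IsIrreducibleInG Ω N (zeroLocus Ω P ∩ torusLocus Ω N) := by
  haveI hprime : (P.map (MvPolynomial.map (algebraMap k Ω))).IsPrime := isPrime_map_of_isAlgClosed P
  have hY' : prodY Ω N ∉ P.map (MvPolynomial.map (algebraMap k Ω)) := by rwa [prodY_mem_map_iff]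
  refine ⟨zeroLocus Ω P, ⟨⟨_, zeroLocus_eq_zeroLocus_map P⟩, ?_⟩, rfl, ?_⟩
  · rw [zeroLocus_eq_zeroLocus_map P, IsPrime.vanishingIdeal_zeroLocus]
    exact hprime
  · rw [zeroLocus_eq_zeroLocus_map P]
    exact zeroLocus_inter_torusLocus_nonempty_of_isPrime _ hY'

/-- The vanishing ideal over `Ω` of `Z_Ω(P) ∩ Gᴺ` is `P Ω[X]`. [folklore] -/
theorem vanishingIdeal_baseChange_inter_torusLocus (P : Ideal (MvPolynomial (Fin N ⊕ Fin N) k))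
    [P.IsPrime] (hY : prodY k N ∉ P) :
    vanishingIdeal Ω (zeroLocus Ω P ∩ torusLocus Ω N) = P.map (MvPolynomial.map (algebraMap k Ω)) := by
  haveI hprime : (P.map (MvPolynomial.map (algebraMap k Ω))).IsPrime := isPrime_map_of_isAlgClosed P
  rw [zeroLocus_eq_zeroLocus_map P]
  exact vanishingIdeal_zeroLocus_inter_torusLocus_of_isPrime _ (by rwa [prodY_mem_map_iff])

/-- The dimension over `Ω` of `Z_Ω(P) ∩ Gᴺ` is `dim k[X] ⧸ P`. [cite: GortzWedhorn2020, Prop. 5.38] -/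
theorem zariskiDim_baseChange_inter_torusLocus_of_isPrime (P : Ideal (MvPolynomial (Fin N ⊕ Fin N) k))
    [P.IsPrime] (hY : prodY k N ∉ P) :
    zariskiDim Ω (zeroLocus Ω P ∩ torusLocus Ω N) = ringKrullDim (MvPolynomial (Fin N ⊕ Fin N) k ⧸ P) := by
  unfold zariskiDim
  rw [vanishingIdeal_baseChange_inter_torusLocus P hY, ringKrullDim_quotient_map_eq_of_isAlgClosed]

/-- **A polynomial over `k` vanishes on `Z_Ω(P) ∩ Gᴺ` iff it lies in `P`** (`P` prime,
`∏ Yᵢ ∉ P`): containment of `Z(P) ∩ Gᴺ` in a `k`-closed set means the same over `k` and over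
`Ω`. [folklore] -/
theorem forall_aeval_eq_zero_iff_mem (P : Ideal (MvPolynomial (Fin N ⊕ Fin N) k)) [P.IsPrime]
    (hY : prodY k N ∉ P) (b : MvPolynomial (Fin N ⊕ Fin N) k) :
    (∀ z ∈ zeroLocus Ω P ∩ torusLocus Ω N, aeval z b = 0) ↔ b ∈ P := by
  constructor
  · intro h
    have h1 : MvPolynomial.map (algebraMap k Ω) b ∈ vanishingIdeal Ω (zeroLocus Ω P ∩ torusLocus Ω N) := by
      rw [mem_vanishingIdeal_iff]
      intro z hz
      rw [aeval_map_algebraMap]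
      exact h z hz
    rw [vanishingIdeal_baseChange_inter_torusLocus P hY] at h1
    exact (Literature.FieldTheory.Regular.map_mem_map_iff P b).1 h1
  · rintro hb z ⟨hz, -⟩
    exact (mem_zeroLocus_iff.1 hz) b hb

omit [CharZero k] [IsAlgClosed k] [IsAlgClosed Ω] in
/-- Evaluation at a `k`-rational point commutes with the embedding. [folklore] -/
theorem aeval_comp_algebraMap (z : Fin N ⊕ Fin N → k) (p : MvPolynomial (Fin N ⊕ Fin N) k) :
    aeval (algebraMap k Ω ∘ z) p = algebraMap k Ω (aeval z p) := by
  rw [show (algebraMap k Ω) (aeval z p) = Algebra.ofId k Ω (aeval z p) from rfl, comp_aeval_apply]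
  rfl

omit [CharZero k] [IsAlgClosed k] [IsAlgClosed Ω] in
/-- A `k`-rational point lies on `Z_Ω(J)` iff it lies on `Z_k(J)`. [folklore] -/
theorem comp_mem_zeroLocus_iff (J : Ideal (MvPolynomial (Fin N ⊕ Fin N) k)) (z : Fin N ⊕ Fin N → k) :
    (algebraMap k Ω ∘ z) ∈ zeroLocus Ω J ↔ z ∈ zeroLocus k J := by
  simp only [mem_zeroLocus_iff, aeval_comp_algebraMap, map_eq_zero_iff _ (algebraMap k Ω).injective]

omit [CharZero k] [IsAlgClosed k] [IsAlgClosed Ω] in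
/-- A `k`-rational point is a torus point over `Ω` iff it is one over `k`. [folklore] -/
theorem comp_mem_torusLocus_iff (z : Fin N ⊕ Fin N → k) :
    (algebraMap k Ω ∘ z) ∈ torusLocus Ω N ↔ z ∈ torusLocus k N := by
  simp only [mem_torusLocus_iff, Function.comp_apply, map_ne_zero_iff _ (algebraMap k Ω).injective]

end BaseChange

/-! ### Linear slices and cosets as zero sets of polynomials over the field of the data -/

section Instances

variable {k : Type*} [Field k] {N : ℕ}

/-- The linear form `∑ⱼ A i j · X_j − κ i` of the slice `Λ_{A,κ}`. [folklore] -/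
def linForm (A : Matrix (Fin N) (Fin N) k) (κ : Fin N → k) (i : Fin N) : MvPolynomial (Fin N ⊕ Fin N) k :=
  (∑ j, C (A i j) * X (Sum.inl j)) - C (κ i)

/-- Evaluating the linear form at a point of an extension. [folklore] -/
theorem aeval_linForm {E : Type*} [CommRing E] [Algebra k E] (z : Fin N ⊕ Fin N → E)
    (A : Matrix (Fin N) (Fin N) k) (κ : Fin N → k) (i : Fin N) :
    aeval z (linForm A κ i) = (A.map (algebraMap k E)).mulVec (z ∘ Sum.inl) i - algebraMap k E (κ i) := by
  simp only [linForm, map_sub, map_sum, map_mul, aeval_C, aeval_X, Matrix.mulVec, dotProduct,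
    Matrix.map_apply, Function.comp_apply]

/-- The coset binomials commute with extension of scalars. [folklore] -/
theorem map_cosetBinomial {E : Type*} [Field E] (f : k →+* E) (c : Fin N → k) (m : Fin N → ℤ) :
    MvPolynomial.map f (cosetBinomial c m) = cosetBinomial (f ∘ c) m := by
  simp only [cosetBinomial, map_sub, map_mul, map_prod, map_pow, map_X, map_C, Function.comp_apply]

/-- Evaluating a coset binomial over `k` at a torus point of an extension `E`: it vanishes iff
the coset equation `(z₂/c)^m = 1` holds. [folklore] -/
theorem aeval_cosetBinomial_eq_zero_iff {E : Type*} [Field E] [Algebra k E] {c : Fin N → k}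
    (hc : ∀ i, c i ≠ 0) {z : Fin N ⊕ Fin N → E} (hz : z ∈ torusLocus E N) (m : Fin N → ℤ) :
    aeval z (cosetBinomial c m) = 0 ↔ ∏ i, (z (Sum.inr i) / algebraMap k E (c i)) ^ m i = 1 := by
  rw [← aeval_map_algebraMap E, map_cosetBinomial, aeval_cosetBinomial, sub_eq_zero,
    prod_div_zpow_eq_one_iff (fun i => (map_ne_zero_iff _ (algebraMap k E).injective).2 (hc i)) hz m]
  exact Iff.rfl

/-- The polynomials (over the field `k` of the data) cutting out the slice
`U_{A,κ} = W ∩ (Λ_{A,κ} × 𝔾ₘᴺ)` of `W = Z(G)`. [folklore] -/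
def sliceSet (G : Set (MvPolynomial (Fin N ⊕ Fin N) k)) (A : Matrix (Fin N) (Fin N) k) (κ : Fin N → k) :
    Set (MvPolynomial (Fin N ⊕ Fin N) k) :=
  G ∪ Set.range (linForm A κ)

/-- The polynomials cutting out `U_{A,κ} ∩ (𝔾ₐᴺ × c·(ker M)°)` on the torus. [folklore] -/
def instSet (G : Set (MvPolynomial (Fin N ⊕ Fin N) k)) (A : Matrix (Fin N) (Fin N) k) (κ : Fin N → k)
    (c : Fin N → k) (M : Matrix (Fin N) (Fin N) ℤ) : Set (MvPolynomial (Fin N ⊕ Fin N) k) :=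
  sliceSet G A κ ∪ cosetBinomial c '' rowSat N M

/-- **The slice over an extension `E` is the torus part of the zero set of `sliceSet`.**
[folklore] -/
theorem zeroLocus_sliceSet_inter_torusLocus (E : Type*) [Field E] [Algebra k E]
    (G : Set (MvPolynomial (Fin N ⊕ Fin N) k)) (A : Matrix (Fin N) (Fin N) k) (κ : Fin N → k) :
    zeroLocus E (Ideal.span (sliceSet G A κ)) ∩ torusLocus E N =
      linSlice N E (zeroLocus E (Ideal.span G)) (A.map (algebraMap k E)) (algebraMap k E ∘ κ) := by
  ext z
  simp only [mem_inter_iff, zeroLocus_span, mem_setOf_eq, sliceSet, mem_union, mem_range,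
    mem_linSlice_iff]
  constructor
  · rintro ⟨h, hzT⟩
    refine ⟨fun p hp => h p (Or.inl hp), hzT, funext fun i => ?_⟩
    have := h _ (Or.inr ⟨i, rfl⟩)
    rwa [aeval_linForm, sub_eq_zero] at this
  · rintro ⟨hG, hzT, hA⟩
    refine ⟨?_, hzT⟩
    rintro p (hp | ⟨i, rfl⟩)
    · exact hG p hp
    · rw [aeval_linForm, hA, Function.comp_apply, sub_self]

/-- **The slice intersected with a coset, over an extension `E`, is the torus part of the zero
set of `instSet`.** [folklore] -/
theorem zeroLocus_instSet_inter_torusLocus (E : Type*) [Field E] [Algebra k E]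
    (G : Set (MvPolynomial (Fin N ⊕ Fin N) k)) (A : Matrix (Fin N) (Fin N) k) (κ : Fin N → k)
    {c : Fin N → k} (hc : ∀ i, c i ≠ 0) (M : Matrix (Fin N) (Fin N) ℤ) :
    zeroLocus E (Ideal.span (instSet G A κ c M)) ∩ torusLocus E N =
      linSlice N E (zeroLocus E (Ideal.span G)) (A.map (algebraMap k E)) (algebraMap k E ∘ κ) ∩
        cosetU N E (algebraMap k E ∘ c) M := by
  rw [← zeroLocus_sliceSet_inter_torusLocus E G A κ]
  ext z
  simp only [mem_inter_iff, zeroLocus_span, mem_setOf_eq, instSet, mem_union, mem_image,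
    mem_cosetU_iff]
  constructor
  · rintro ⟨h, hzT⟩
    refine ⟨⟨fun p hp => h p (Or.inl hp), hzT⟩, hzT, fun m hm => ?_⟩
    exact (aeval_cosetBinomial_eq_zero_iff hc hzT m).1 (h _ (Or.inr ⟨m, hm, rfl⟩))
  · rintro ⟨⟨h, hzT⟩, -, hcos⟩
    refine ⟨?_, hzT⟩
    rintro p (hp | ⟨m, hm, rfl⟩)
    · exact h p hp
    · exact (aeval_cosetBinomial_eq_zero_iff hc hzT m).2 (hcos m hm)

/-- Over the field of the data itself. [folklore] -/
theorem zeroLocus_sliceSet_inter_torusLocus_self (G : Set (MvPolynomial (Fin N ⊕ Fin N) k))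
    (A : Matrix (Fin N) (Fin N) k) (κ : Fin N → k) :
    zeroLocus k (Ideal.span (sliceSet G A κ)) ∩ torusLocus k N =
      linSlice N k (zeroLocus k (Ideal.span G)) A κ := by
  have h := zeroLocus_sliceSet_inter_torusLocus k G A κ
  have h1 : A.map (algebraMap k k) = A := by ext i j; rfl
  have h2 : ((algebraMap k k : k → k) ∘ κ) = κ := rfl
  rwa [h1, h2] at h

/-- Over the field of the data itself. [folklore] -/
theorem zeroLocus_instSet_inter_torusLocus_self (G : Set (MvPolynomial (Fin N ⊕ Fin N) k))
    (A : Matrix (Fin N) (Fin N) k) (κ : Fin N → k) {c : Fin N → k} (hc : ∀ i, c i ≠ 0)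
    (M : Matrix (Fin N) (Fin N) ℤ) :
    zeroLocus k (Ideal.span (instSet G A κ c M)) ∩ torusLocus k N =
      linSlice N k (zeroLocus k (Ideal.span G)) A κ ∩ cosetU N k c M := by
  have h := zeroLocus_instSet_inter_torusLocus k G A κ hc M
  have h1 : A.map (algebraMap k k) = A := by ext i j; rfl
  have h2 : ((algebraMap k k : k → k) ∘ κ) = κ := rfl
  have h3 : ((algebraMap k k : k → k) ∘ c) = c := rfl
  rwa [h1, h2, h3] at h

end Instances

/-! ### Descent of the weak Zilber–Pink bound along an extension of algebraically closed fields -/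

section Descent

variable {k : Type*} {Ω : Type*} [Field k] [CharZero k] [IsAlgClosed k] [Field Ω] [IsAlgClosed Ω]
  [Algebra k Ω] {N : ℕ}

/-- **Descent of `WeakZPBound` to an algebraically closed subfield** (Lefschetz principle for the
horizontal weak Zilber–Pink bound, Bays–Kirby 2018, Thm 11.4). If the finite set `𝓗` controls the
atypical components of the linear slices of `W_Ω = Z_Ω(G)` over `Ω`, then it controls, over the
algebraically closed subfield `k` of the coefficients `G`, every *irreducible* `k`-subvariety
`X = Z_k(P) ∩ Gᴺ` of a slice-coset intersection of atypical dimension (irreducible components or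
not): `X` extends to the irreducible `Z_Ω(P) ∩ Gᴺ`, contained in a component of the extended
intersection, of at least the same — atypical — dimension; the subgroup `H ∈ 𝓗` found over `Ω`
works over `k` because dimensions, containment in `k`-closed sets and rational points do not
change (`zariskiDim_baseChange_inter_torusLocus`, `forall_aeval_eq_zero_iff_mem`).
[cite: BaysKirby2018ANT, Thm 11.4] -/
theorem weakZPBound_descend (G : Set (MvPolynomial (Fin N ⊕ Fin N) k))
    {𝓗 : Finset (Matrix (Fin N) (Fin N) ℤ)} (hΩ : WeakZPBound Ω N (zeroLocus Ω (Ideal.span G)) 𝓗)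
    (A : Matrix (Fin N) (Fin N) k) (κ : Fin N → k) (MJ : Matrix (Fin N) (Fin N) ℤ) {c : Fin N → k}
    (hc : ∀ i, c i ≠ 0) (P : Ideal (MvPolynomial (Fin N ⊕ Fin N) k)) [P.IsPrime]
    (hY : prodY k N ∉ P)
    (hsub : zeroLocus k P ∩ torusLocus k N ⊆
      linSlice N k (zeroLocus k (Ideal.span G)) A κ ∩ cosetU N k c MJ)
    (hatyp : zariskiDim k (linSlice N k (zeroLocus k (Ideal.span G)) A κ) +
        ((N - (MJ.map (Int.cast : ℤ → ℚ)).rank : ℕ) : WithBot ℕ∞) <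
      zariskiDim k (zeroLocus k P ∩ torusLocus k N) + (N : WithBot ℕ∞))
    {x : Fin N ⊕ Fin N → k} (hx : x ∈ zeroLocus k P ∩ torusLocus k N) :
    ∃ MH ∈ 𝓗, zeroLocus k P ∩ torusLocus k N ⊆ cosetU N k (x ∘ Sum.inr) MH ∧
      zariskiDim k (zeroLocus k P ∩ torusLocus k N) +
          (((Matrix.fromRows MH MJ).map (Int.cast : ℤ → ℚ)).rank : WithBot ℕ∞) ≤
        zariskiDim k (linSlice N k (zeroLocus k (Ideal.span G)) A κ ∩ cosetU N k (x ∘ Sum.inr) MH) +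
          ((MH.map (Int.cast : ℤ → ℚ)).rank : WithBot ℕ∞) := by
  -- notation
  set φ := algebraMap k Ω with hφ
  set Xk := zeroLocus k P ∩ torusLocus k N with hXk
  set XΩ := zeroLocus Ω P ∩ torusLocus Ω N with hXΩ
  set WΩ := zeroLocus Ω (Ideal.span G) with hWΩ
  set Wk := zeroLocus k (Ideal.span G) with hWk
  have hc' : ∀ i, (φ ∘ c) i ≠ 0 := fun i => (map_ne_zero_iff _ (algebraMap k Ω).injective).2 (hc i)
  have hxT : x ∈ torusLocus k N := hx.2
  have hx₂ : ∀ i, (x ∘ Sum.inr) i ≠ 0 := fun i => hxT i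
  -- polynomials over `k` vanishing on `X_k` lie in `P`, hence vanish on `X_Ω`
  have hvan : ∀ p : MvPolynomial (Fin N ⊕ Fin N) k, (∀ z ∈ Xk, aeval z p = 0) → ∀ z ∈ XΩ, aeval z p = 0 :=
    fun p hp => (forall_aeval_eq_zero_iff_mem (Ω := Ω) P hY p).2
      ((forall_aeval_eq_zero_iff_mem (Ω := k) P hY p).1 hp)
  -- `X_Ω ⊆ U_Ω ∩ coset_Ω`
  have hsubΩ : XΩ ⊆ linSlice N Ω WΩ (A.map φ) (φ ∘ κ) ∩ cosetU N Ω (φ ∘ c) MJ := by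
    rw [← zeroLocus_instSet_inter_torusLocus Ω G A κ hc MJ]
    rintro z ⟨hz, hzT⟩
    refine ⟨?_, hzT⟩
    rw [zeroLocus_span]
    intro p hp
    refine hvan p (fun w hw => ?_) z ⟨hz, hzT⟩
    have hw' : w ∈ zeroLocus k (Ideal.span (instSet G A κ c MJ)) ∩ torusLocus k N := by
      rw [zeroLocus_instSet_inter_torusLocus_self G A κ hc MJ]; exact hsub hw
    rw [zeroLocus_span] at hw'
    exact hw'.1 p hp
  -- an irreducible component `X'` of the intersection over `Ω` containing `X_Ω`
  have hWΩ' : IsZariskiClosed Ω WΩ := ⟨_, zeroLocus_eq_zeroLocus_map (Ideal.span G)⟩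
  have hclosed : IsClosedInG Ω N (linSlice N Ω WΩ (A.map φ) (φ ∘ κ) ∩ cosetU N Ω (φ ∘ c) MJ) :=
    isClosedInG_linSlice_inter_cosetU hWΩ' _ _ hc' MJ
  obtain ⟨X', hX'comp, hX'sub⟩ := exists_isIrredComponentInG_superset hclosed
    (isIrreducibleInG_baseChange P hY) hsubΩ
  -- dimensions
  have hdimX : zariskiDim Ω XΩ = zariskiDim k Xk := by
    rw [hXΩ, hXk, zariskiDim_baseChange_inter_torusLocus_of_isPrime (Ω := Ω) P hY,
      zariskiDim_baseChange_inter_torusLocus_of_isPrime (Ω := k) P hY]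
  have hslice : zariskiDim Ω (linSlice N Ω WΩ (A.map φ) (φ ∘ κ)) = zariskiDim k (linSlice N k Wk A κ) := by
    rw [← zeroLocus_sliceSet_inter_torusLocus Ω G A κ, ← zeroLocus_sliceSet_inter_torusLocus_self G A κ]
    exact zariskiDim_baseChange_inter_torusLocus _
  have hXX' : zariskiDim k Xk ≤ zariskiDim Ω X' := hdimX ▸ zariskiDim_mono hX'sub
  have hatypΩ : zariskiDim Ω (linSlice N Ω WΩ (A.map φ) (φ ∘ κ)) +
      ((N - (MJ.map (Int.cast : ℤ → ℚ)).rank : ℕ) : WithBot ℕ∞) < zariskiDim Ω X' + (N : WithBot ℕ∞) := by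
    rw [hslice]
    exact lt_of_lt_of_le hatyp (add_le_add_left hXX' _)
  -- the rational point
  have hx' : (φ ∘ x) ∈ X' := hX'sub ⟨(comp_mem_zeroLocus_iff P x).2 hx.1, (comp_mem_torusLocus_iff x).2 hxT⟩
  -- apply the bound over `Ω`
  obtain ⟨MH, hMH, hcos, hstar⟩ := hΩ (A.map φ) (φ ∘ κ) MJ (φ ∘ c) X' hc' hX'comp hatypΩ (φ ∘ x) hx'
  refine ⟨MH, hMH, ?_, ?_⟩
  · -- containment, back over `k`
    rintro z hz
    refine ⟨hz.2, fun m hm => ?_⟩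
    have hb : cosetBinomial (x ∘ Sum.inr) m ∈ P := by
      refine (forall_aeval_eq_zero_iff_mem (Ω := Ω) P hY _).1 fun w hw => ?_
      have hw' := hcos (hX'sub hw)
      exact (aeval_cosetBinomial_eq_zero_iff hx₂ hw.2 m).2 (hw'.2 m hm)
    have h0 : aeval z (cosetBinomial (x ∘ Sum.inr) m) = 0 := (mem_zeroLocus_iff.1 hz.1) _ hb
    have := (aeval_cosetBinomial_eq_zero_iff (E := k) hx₂ hz.2 m).1 h0
    simpa using this
  · -- the inequality `(*)`, back over `k`
    have hdim' : zariskiDim Ω (linSlice N Ω WΩ (A.map φ) (φ ∘ κ) ∩ cosetU N Ω ((φ ∘ x) ∘ Sum.inr) MH) =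
        zariskiDim k (linSlice N k Wk A κ ∩ cosetU N k (x ∘ Sum.inr) MH) := by
      rw [show ((φ ∘ x) ∘ Sum.inr) = φ ∘ (x ∘ Sum.inr) from rfl,
        ← zeroLocus_instSet_inter_torusLocus Ω G A κ hx₂ MH,
        ← zeroLocus_instSet_inter_torusLocus_self G A κ hx₂ MH]
      exact zariskiDim_baseChange_inter_torusLocus _
    rw [← hdim']
    exact le_trans (add_le_add_left hXX' _) hstar

end Descent

open Cardinal

/-! ### Algebraically independent complex numbers over a countable subfield -/

section Complex

variable {L₀ : Type*} [Field L₀] [Countable L₀] [Algebra L₀ ℂ]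

/-- An intermediate field of `ℂ` generated over a countable field by finitely many elements is
countable. [folklore] -/
theorem countable_adjoin_of_finite {s : Set ℂ} (hs : s.Finite) :
    Countable (IntermediateField.adjoin L₀ s) := by
  have h1 : #(IntermediateField.adjoin L₀ s) ≤ ℵ₀ := by
    change #((IntermediateField.adjoin L₀ s).toSubfield) ≤ ℵ₀
    rw [IntermediateField.adjoin_toSubfield]
    refine (Subfield.cardinalMk_closure_le_max _).trans (max_le ?_ le_rfl)
    rw [Cardinal.le_aleph0_iff_set_countable]
    exact (Set.countable_range _).union hs.countable
  exact Cardinal.mk_le_aleph0_iff.1 h1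

set_option synthInstance.maxHeartbeats 400000 in
omit [Countable L₀] in
/-- **Over a countable subfield of `ℂ` there are transcendental numbers**: for a countable
intermediate field `K ⊆ ℂ` some complex number is transcendental over `K` (the algebraic closure
of `K` in `ℂ` is countable). [folklore] -/
theorem exists_transcendental_of_countable (K : IntermediateField L₀ ℂ) [Countable K] :
    ∃ z : ℂ, Transcendental K z := by
  have h1 : #(algebraicClosure K ℂ) ≤ ℵ₀ := by
    refine (Algebra.IsAlgebraic.cardinalMk_le_max K (algebraicClosure K ℂ)).trans (max_le ?_ le_rfl)
    exact Cardinal.mk_le_aleph0_iff.2 inferInstance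
  have h2 : ((algebraicClosure K ℂ : Set ℂ)) ≠ Set.univ := by
    intro h
    have h3 : #((algebraicClosure K ℂ : Set ℂ)) = 𝔠 := by rw [h, Cardinal.mk_univ_complex]
    have : (𝔠 : Cardinal) ≤ ℵ₀ := h3 ▸ h1
    exact (Cardinal.aleph0_lt_continuum.not_ge this)
  obtain ⟨z, hz⟩ := (Set.ne_univ_iff_exists_notMem _).1 h2
  refine ⟨z, fun halg => hz ?_⟩
  exact (mem_algebraicClosure_iff).2 halg

/-- **Algebraically independent complex numbers over a countable field**: for every `n` there are
`n` complex numbers algebraically independent over (the image of) the countable field `L₀`.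
[folklore] -/
theorem exists_algebraicIndependent_complex (n : ℕ) : ∃ w : Fin n → ℂ, AlgebraicIndependent L₀ w := by
  induction n with
  | zero => exact ⟨Fin.elim0, (algebraicIndependent_empty_type_iff).2 (algebraMap L₀ ℂ).injective⟩
  | succ n ih =>
    obtain ⟨w, hw⟩ := ih
    set K : IntermediateField L₀ ℂ := IntermediateField.adjoin L₀ (Set.range w) with hK
    haveI : Countable K := countable_adjoin_of_finite (Set.finite_range w)
    obtain ⟨z, hz⟩ := exists_transcendental_of_countable K
    have hz' : Transcendental (Algebra.adjoin L₀ (Set.range w)) z :=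
      (IntermediateField.transcendental_adjoin_iff).1 hz
    have h := (hw.option_iff_transcendental z).2 hz'
    exact ⟨(fun o : Option (Fin n) => o.elim z w) ∘ finSuccEquiv n, (algebraicIndependent_equiv (finSuccEquiv n)).2 h⟩

end Complex

/-! ### Embedding into `ℂ` over a countable subfield -/

section Embedding

variable {L₀ L : Type*} [Field L₀] [Countable L₀] [Field L] [Algebra L₀ L]

/-- **Extension of embeddings into `ℂ`** (Steinitz): if `L` is algebraic over the purely
transcendental field `L₀(b)` (`b` a finite algebraically independent family in some field `F'`,
acting on `L` through `L₀(b) → L`) and `L₀` is countable, every embedding `τ₀ : L₀ → ℂ` extends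
to an embedding `τ : L → ℂ` (send `b` to complex numbers algebraically independent over `τ₀(L₀)`,
extend to `L₀(b) ≅ Frac L₀[X]`, then lift along the algebraic extension `L / L₀(b)` into the
algebraically closed field `ℂ`). [folklore] -/
theorem exists_ringHom_comp_algebraMap_eq {F' : Type*} [Field F'] [Algebra L₀ F'] {n : ℕ}
    {b : Fin n → F'} (hb : AlgebraicIndependent L₀ b) (L : Type*) [Field L] [Algebra L₀ L]
    [Algebra (IntermediateField.adjoin L₀ (Set.range b)) L]
    [IsScalarTower L₀ (IntermediateField.adjoin L₀ (Set.range b)) L]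
    [Algebra.IsAlgebraic (IntermediateField.adjoin L₀ (Set.range b)) L] (τ₀ : L₀ →+* ℂ) :
    ∃ τ : L →+* ℂ, τ.comp (algebraMap L₀ L) = τ₀ := by
  letI : Algebra L₀ ℂ := τ₀.toAlgebra
  obtain ⟨w, hw⟩ := exists_algebraicIndependent_complex (L₀ := L₀) n
  have hwinj : Function.Injective (MvPolynomial.aeval w : MvPolynomial (Fin n) L₀ →ₐ[L₀] ℂ) :=
    (algebraicIndependent_iff_injective_aeval).1 hw
  let ψ₁' : FractionRing (MvPolynomial (Fin n) L₀) →ₐ[L₀] ℂ := IsFractionRing.liftAlgHom hwinj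
  let ψ₁ : IntermediateField.adjoin L₀ (Set.range b) →ₐ[L₀] ℂ :=
    ψ₁'.comp (hb.aevalEquivField.symm :
      IntermediateField.adjoin L₀ (Set.range b) →ₐ[L₀] FractionRing (MvPolynomial (Fin n) L₀))
  letI : Algebra (IntermediateField.adjoin L₀ (Set.range b)) ℂ := ψ₁.toRingHom.toAlgebra
  let τ' : L →ₐ[IntermediateField.adjoin L₀ (Set.range b)] ℂ := IsAlgClosed.lift
  refine ⟨τ'.toRingHom, RingHom.ext fun a => ?_⟩
  have h1 : algebraMap L₀ L a = algebraMap (IntermediateField.adjoin L₀ (Set.range b)) L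
      (algebraMap L₀ (IntermediateField.adjoin L₀ (Set.range b)) a) :=
    IsScalarTower.algebraMap_apply _ _ _ a
  rw [RingHom.comp_apply, AlgHom.toRingHom_eq_coe, RingHom.coe_coe, h1, τ'.commutes]
  change ψ₁ (algebraMap L₀ (IntermediateField.adjoin L₀ (Set.range b)) a) = τ₀ a
  rw [ψ₁.commutes]
  rfl

end Embedding

/-! ### Countable algebraically closed fields of definition inside an algebraically closed field -/

section DefField

variable {F : Type u} [Field F] (L₀ : Type*) [Field L₀] [Algebra L₀ F] (S : Set F)

/-- **The field of definition** attached to a set `S ⊆ F` over `L₀`: the relative algebraic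
closure in `F` of the field `L₀(S)`, as an intermediate field of `F / L₀`. [folklore] -/
def defField : IntermediateField L₀ F :=
  (algebraicClosure (IntermediateField.adjoin L₀ S) F).restrictScalars L₀

variable {L₀ S}

/-- Membership in the field of definition: being algebraic over `L₀(S)`. [folklore] -/
theorem mem_defField_iff {x : F} : x ∈ defField L₀ S ↔ IsAlgebraic (IntermediateField.adjoin L₀ S) x := by
  rw [defField, IntermediateField.mem_restrictScalars, mem_algebraicClosure_iff]

/-- `S` lies in its field of definition. [folklore] -/
theorem subset_defField : S ⊆ (defField L₀ S : Set F) := fun x hx =>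
  mem_defField_iff.2 (isAlgebraic_algebraMap
    (⟨x, IntermediateField.subset_adjoin L₀ S hx⟩ : IntermediateField.adjoin L₀ S))

/-- The image of `L₀` lies in the field of definition. [folklore] -/
theorem algebraMap_mem_defField (a : L₀) : algebraMap L₀ F a ∈ defField L₀ S :=
  (defField L₀ S).algebraMap_mem a

variable (L₀ S)

set_option synthInstance.maxHeartbeats 400000 in
/-- **The field of definition is algebraically closed** when `F` is: a root in `F` of a polynomial
over it is algebraic over it, hence over `L₀(S)`. [folklore] -/
theorem isAlgClosed_defField [IsAlgClosed F] : IsAlgClosed (defField L₀ S) := by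
  set E := IntermediateField.adjoin L₀ S with hE
  haveI : IsAlgClosure E (algebraicClosure E F) := inferInstance
  exact IsAlgClosure.isAlgClosed E (K := algebraicClosure E F)

set_option synthInstance.maxHeartbeats 400000 in
/-- **The field of definition of finitely many elements over a countable field is countable.**
[folklore] -/
theorem countable_defField [Countable L₀] (hS : S.Finite) : Countable (defField L₀ S) := by
  set E := IntermediateField.adjoin L₀ S with hE
  have h1 : #E ≤ ℵ₀ := by
    change #(E.toSubfield) ≤ ℵ₀
    rw [hE, IntermediateField.adjoin_toSubfield]
    refine (Subfield.cardinalMk_closure_le_max _).trans (max_le ?_ le_rfl)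
    rw [Cardinal.le_aleph0_iff_set_countable]
    exact (Set.countable_range _).union hS.countable
  have h2 : #(algebraicClosure E F) ≤ ℵ₀ :=
    (Algebra.IsAlgebraic.cardinalMk_le_max E (algebraicClosure E F)).trans (max_le h1 le_rfl)
  exact Cardinal.mk_le_aleph0_iff.1 h2

/-- **Embedding the field of definition into `ℂ` over `L₀`** (characteristic zero, `L₀`
countable, `S` finite): every embedding `τ₀ : L₀ → ℂ` extends to the field of definition of `S`.
[folklore] -/
theorem exists_defField_ringHom [Countable L₀] (hS : S.Finite) (τ₀ : L₀ →+* ℂ) :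
    ∃ τ : defField L₀ S →+* ℂ, τ.comp (algebraMap L₀ (defField L₀ S)) = τ₀ := by
  classical
  set K : IntermediateField L₀ F := defField L₀ S with hK
  -- a transcendence basis of `L₀(S)` among `S`
  obtain ⟨B, hB⟩ := (AlgebraicIndependent.matroid L₀ F).exists_isBasis S
  have hB' := AlgebraicIndependent.matroid_isBasis_iff.1 hB
  have hBS : B ⊆ S := hB'.2.1
  have hBfin : B.Finite := hS.subset hBS
  obtain ⟨n, f, hf⟩ := hBfin.fin_embedding
  set b : Fin n → F := ⇑f with hb
  have hbind : AlgebraicIndependent L₀ b := by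
    have h1 : AlgebraicIndependent L₀ ((↑) : Set.range b → F) := by
      rw [hb, hf]; exact hB'.1
    exact (algebraicIndependent_subtype_range f.injective).1 h1
  set Kb : IntermediateField L₀ F := IntermediateField.adjoin L₀ (Set.range b) with hKb
  -- `L₀(b) ≤ K`
  have hle : Kb ≤ K := by
    rw [hKb, IntermediateField.adjoin_le_iff]
    rintro _ ⟨i, rfl⟩
    exact subset_defField (hBS (hf ▸ ⟨i, rfl⟩))
  letI : Algebra Kb K := (IntermediateField.inclusion hle).toAlgebra
  haveI : IsScalarTower L₀ Kb K := IsScalarTower.of_algebraMap_eq fun a => rfl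
  haveI : IsScalarTower Kb K F := IsScalarTower.of_algebraMap_eq fun a => rfl
  -- `K` is algebraic over `L₀(b)`
  haveI : Algebra.IsAlgebraic Kb K := by
    refine ⟨fun x => ?_⟩
    have hx : IsAlgebraic (IntermediateField.adjoin L₀ S) (x : F) := mem_defField_iff.1 x.2
    rw [IntermediateField.isAlgebraic_adjoin_iff,
      ← AlgebraicIndependent.isAlgebraic_adjoin_iff_of_matroid_isBasis hB, ← hf,
      ← IntermediateField.isAlgebraic_adjoin_iff] at hx
    exact (isAlgebraic_algebraMap_iff (algebraMap K F).injective).1 hx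
  exact exists_ringHom_comp_algebraMap_eq hbind K τ₀

end DefField

/-! ### Lifting polynomials to a subfield containing their coefficients -/

/-- A polynomial all of whose coefficients lie in an intermediate field `K` is the image of a
polynomial over `K`. [folklore] -/
theorem exists_map_eq_of_coeffs_subset {L₀ F : Type*} [Field L₀] [Field F] [Algebra L₀ F]
    (K : IntermediateField L₀ F) {ι : Type*} (g : MvPolynomial ι F) (hg : ↑g.coeffs ⊆ (K : Set F)) :
    ∃ g' : MvPolynomial ι K, MvPolynomial.map (algebraMap K F) g' = g := by
  classical
  let c' : (ι →₀ ℕ) → K := fun m => if h : g.coeff m ∈ K then ⟨g.coeff m, h⟩ else 0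
  refine ⟨∑ m ∈ g.support, monomial m (c' m), ?_⟩
  rw [map_sum]
  conv_rhs => rw [as_sum g]
  refine Finset.sum_congr rfl fun m hm => ?_
  rw [map_monomial]
  congr 1
  have hmem : g.coeff m ∈ K := hg (coeff_mem_coeffs m (mem_support_iff.1 hm))
  simp only [c', dif_pos hmem]
  rfl

/-- Finitely many polynomials have a common finite set of coefficients. [folklore] -/
theorem coeffs_subset_biUnion {F : Type*} [Field F] {ι : Type*} [DecidableEq F]
    (G : Finset (MvPolynomial ι F)) {g : MvPolynomial ι F} (hg : g ∈ G) :
    (↑g.coeffs : Set F) ⊆ ↑(G.biUnion fun g => g.coeffs) := by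
  intro a ha
  rw [Finset.mem_coe, Finset.mem_biUnion]
  exact ⟨g, hg, ha⟩

end WeakZPTransfer

open WeakZPTransfer

/-! ### The transfer -/

set_option maxHeartbeats 1600000 in
/-- **The horizontal weak Zilber–Pink bound over every algebraically closed field of
characteristic zero** (Bays–Kirby 2018, Thm 11.4 for `S = 𝔾ₘᴺ`, `U = 𝔾ₐᴺ` and linear slices, in
the form `Literature.NumberTheory.Transcendental.WeakZPBound`): transferred from `ℂ`
(`WeakZP.weakZPBound_complex`) by the Lefschetz principle. [cite: BaysKirby2018ANT, Thm 11.4] -/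
theorem weakZPBound_of_isAlgClosed {F : Type u} [Field F] [CharZero F] (hF : IsAlgClosed F) (N : ℕ)
    (W : Set (Fin N ⊕ Fin N → F)) (hW : IsZariskiClosed F W) :
    ∃ 𝓗 : Finset (Matrix (Fin N) (Fin N) ℤ), WeakZPBound F N W 𝓗 := by
  classical
  haveI := hF
  -- Step 1: generators of `I(W)` and their field of definition `K₁`
  obtain ⟨GF, hGF⟩ : ∃ GF : Finset (MvPolynomial (Fin N ⊕ Fin N) F),
      Ideal.span (GF : Set (MvPolynomial (Fin N ⊕ Fin N) F)) = vanishingIdeal F W :=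
    (inferInstance : IsNoetherian _ _).noetherian (vanishingIdeal F W)
  have hWeq : zeroLocus F (Ideal.span (GF : Set (MvPolynomial (Fin N ⊕ Fin N) F))) = W := by
    rw [hGF]; exact hW.zeroLocus_vanishingIdeal
  set S₁ : Set F := ↑(GF.biUnion fun g => g.coeffs) with hS₁
  have hS₁fin : S₁.Finite := Finset.finite_toSet _
  set K₁ : IntermediateField ℚ F := defField ℚ S₁ with hK₁
  haveI : IsAlgClosed K₁ := isAlgClosed_defField ℚ S₁
  haveI : Countable K₁ := countable_defField ℚ S₁ hS₁fin
  obtain ⟨σ₀, -⟩ := exists_defField_ringHom ℚ S₁ hS₁fin (algebraMap ℚ ℂ)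
  -- lift the generators to `K₁`
  have hlift : ∀ g ∈ GF, ∃ g' : MvPolynomial (Fin N ⊕ Fin N) K₁, MvPolynomial.map (algebraMap K₁ F) g' = g :=
    fun g hg => exists_map_eq_of_coeffs_subset K₁ g ((coeffs_subset_biUnion GF hg).trans subset_defField)
  choose lift hlift using hlift
  set G₁ : Set (MvPolynomial (Fin N ⊕ Fin N) K₁) := Set.range (fun g : GF => lift g.1 g.2) with hG₁
  have hWK₁ : zeroLocus F (Ideal.span G₁) = W := by
    rw [← hWeq]
    ext z
    simp only [zeroLocus_span, mem_setOf_eq, hG₁, Set.mem_range, forall_exists_index, Finset.mem_coe]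
    constructor
    · intro h g hg
      have := h (lift g hg) ⟨g, hg⟩ rfl
      rwa [← aeval_map_algebraMap F, hlift g hg] at this
    · rintro h _ ⟨g, hg⟩ rfl
      rw [← aeval_map_algebraMap F, hlift g hg]
      exact h g hg
  -- Step 2: `W_ℂ` and its finite set of subgroups
  letI algK₁ℂ : Algebra K₁ ℂ := σ₀.toAlgebra
  set Wℂ : Set (Fin N ⊕ Fin N → ℂ) := zeroLocus ℂ (Ideal.span G₁) with hWℂ
  have hWℂclosed : IsZariskiClosed ℂ Wℂ := ⟨_, zeroLocus_eq_zeroLocus_map (Ideal.span G₁)⟩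
  obtain ⟨𝓗, h𝓗⟩ := WeakZP.weakZPBound_complex (N := N) hWℂclosed
  refine ⟨𝓗, ?_⟩
  -- Step 3: an instance over `F`
  intro A κ MJ c X hc hcomp hatyp x hx
  obtain ⟨⟨Xc, hXc, hXeq, hXne⟩, hXS, -⟩ := hcomp
  set PF : Ideal (MvPolynomial (Fin N ⊕ Fin N) F) := vanishingIdeal F Xc with hPF
  haveI hPFprime : PF.IsPrime := hXc.2
  have hXc_eq : Xc = zeroLocus F PF := (hXc.1.zeroLocus_vanishingIdeal).symm
  obtain ⟨GX, hGX⟩ : ∃ GX : Finset (MvPolynomial (Fin N ⊕ Fin N) F),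
      Ideal.span (GX : Set (MvPolynomial (Fin N ⊕ Fin N) F)) = PF :=
    (inferInstance : IsNoetherian _ _).noetherian PF
  -- the field of definition `K₂ ⊇ K₁` of the instance
  set S₂ : Set F := (Set.range (fun p : Fin N × Fin N => A p.1 p.2) ∪ Set.range κ ∪ Set.range c ∪
      Set.range x) ∪ ↑(GX.biUnion fun g => g.coeffs) with hS₂
  have hS₂fin : S₂.Finite :=
    ((((Set.finite_range _).union (Set.finite_range _)).union (Set.finite_range _)).union
      (Set.finite_range _)).union (Finset.finite_toSet _)
  set K₂ : IntermediateField K₁ F := defField K₁ S₂ with hK₂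
  haveI : IsAlgClosed K₂ := isAlgClosed_defField K₁ S₂
  obtain ⟨σ₂, hσ₂⟩ := exists_defField_ringHom K₁ S₂ hS₂fin σ₀
  have hmemA : ∀ i j, A i j ∈ K₂ := fun i j =>
    subset_defField (Or.inl (Or.inl (Or.inl (Or.inl ⟨(i, j), rfl⟩))))
  have hmemκ : ∀ i, κ i ∈ K₂ := fun i => subset_defField (Or.inl (Or.inl (Or.inl (Or.inr ⟨i, rfl⟩))))
  have hmemc : ∀ i, c i ∈ K₂ := fun i => subset_defField (Or.inl (Or.inl (Or.inr ⟨i, rfl⟩)))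
  have hmemx : ∀ j, x j ∈ K₂ := fun j => subset_defField (Or.inl (Or.inr ⟨j, rfl⟩))
  set A₂ : Matrix (Fin N) (Fin N) K₂ := fun i j => ⟨A i j, hmemA i j⟩ with hA₂
  set κ₂ : Fin N → K₂ := fun i => ⟨κ i, hmemκ i⟩ with hκ₂
  set c₂ : Fin N → K₂ := fun i => ⟨c i, hmemc i⟩ with hc₂
  set x₂ : Fin N ⊕ Fin N → K₂ := fun j => ⟨x j, hmemx j⟩ with hx₂
  have hA₂F : A₂.map (algebraMap K₂ F) = A := by ext i j; rfl
  have hκ₂F : (algebraMap K₂ F) ∘ κ₂ = κ := rfl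
  have hc₂F : (algebraMap K₂ F) ∘ c₂ = c := rfl
  have hx₂F : (algebraMap K₂ F) ∘ x₂ = x := rfl
  have hx₂F' : (algebraMap K₂ F) ∘ (x₂ ∘ Sum.inr) = x ∘ Sum.inr := rfl
  have hc₂' : ∀ i, c₂ i ≠ 0 := fun i h => hc i (by rw [← hc₂F, Function.comp_apply, h, map_zero])
  have hx₂' : ∀ i, (x₂ ∘ Sum.inr) i ≠ 0 := fun i h => by
    have hxT : x ∈ torusLocus F N := by rw [hXeq] at hx; exact hx.2
    refine hxT i ?_
    have h' := congrArg (algebraMap K₂ F) h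
    rw [map_zero] at h'
    exact h'
  -- the prime `P₂` of `X` over `K₂`
  set P₂ : Ideal (MvPolynomial (Fin N ⊕ Fin N) K₂) := PF.comap (MvPolynomial.map (algebraMap K₂ F)) with hP₂
  haveI hP₂prime : P₂.IsPrime := Ideal.IsPrime.comap _
  have hliftX : ∀ g ∈ GX, ∃ g' : MvPolynomial (Fin N ⊕ Fin N) K₂, MvPolynomial.map (algebraMap K₂ F) g' = g :=
    fun g hg => exists_map_eq_of_coeffs_subset K₂ g ((coeffs_subset_biUnion GX hg).trans
      (Set.Subset.trans (fun a ha => Or.inr ha) subset_defField))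
  have hPFmap : PF = P₂.map (MvPolynomial.map (algebraMap K₂ F)) := by
    refine le_antisymm ?_ Ideal.map_comap_le
    rw [← hGX, Ideal.span_le]
    intro g hg
    obtain ⟨g', hg'⟩ := hliftX g hg
    have hg'P : g' ∈ P₂ := by
      rw [hP₂, Ideal.mem_comap, hg', ← hGX]; exact Ideal.subset_span hg
    rw [← hg']
    exact Ideal.mem_map_of_mem _ hg'P
  have hXc₂ : Xc = zeroLocus F P₂ := by
    rw [hXc_eq, hPFmap, ← zeroLocus_eq_zeroLocus_map P₂]
  have hX₂ : X = zeroLocus F P₂ ∩ torusLocus F N := by rw [hXeq, hXc₂]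
  have hY₂ : prodY K₂ N ∉ P₂ := by
    intro hY
    rw [hP₂, Ideal.mem_comap, map_prodY] at hY
    obtain ⟨z, hz⟩ := hXne
    rw [hXeq] at hz
    have h0 := (mem_vanishingIdeal_iff.1 hY) z hz.1
    exact (aeval_prodY_ne_zero_iff z).2 hz.2 h0
  -- `W` over `K₂`
  set G₂ : Set (MvPolynomial (Fin N ⊕ Fin N) K₂) := (MvPolynomial.map (algebraMap K₁ K₂)) '' G₁ with hG₂
  have hWK₂ : zeroLocus F (Ideal.span G₂) = W := by
    rw [← hWK₁]
    ext z
    simp only [zeroLocus_span, mem_setOf_eq, hG₂, Set.mem_image, forall_exists_index, and_imp,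
      forall_apply_eq_imp_iff₂]
    refine forall_congr' fun g => forall_congr' fun _ => ?_
    rw [aeval_map_algebraMap]
  -- `W_ℂ` over `K₂`
  letI algK₂ℂ : Algebra K₂ ℂ := σ₂.toAlgebra
  haveI : IsScalarTower K₁ K₂ ℂ := IsScalarTower.of_algebraMap_eq fun a => by
    change σ₀ a = σ₂ (algebraMap K₁ K₂ a)
    rw [← hσ₂]; rfl
  have hWℂ₂ : zeroLocus ℂ (Ideal.span G₂) = Wℂ := by
    rw [hWℂ]
    ext z
    simp only [zeroLocus_span, mem_setOf_eq, hG₂, Set.mem_image, forall_exists_index, and_imp,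
      forall_apply_eq_imp_iff₂]
    refine forall_congr' fun g => forall_congr' fun _ => ?_
    rw [aeval_map_algebraMap]
  have h𝓗₂ : WeakZPBound ℂ N (zeroLocus ℂ (Ideal.span G₂)) 𝓗 := by rw [hWℂ₂]; exact h𝓗
  -- identifications over `F`
  have hsliceF : zeroLocus F (Ideal.span (sliceSet G₂ A₂ κ₂)) ∩ torusLocus F N = linSlice N F W A κ := by
    rw [zeroLocus_sliceSet_inter_torusLocus F G₂ A₂ κ₂, hWK₂, hA₂F, hκ₂F]
  have hinstF : ∀ {d : Fin N → K₂} (hd : ∀ i, d i ≠ 0) (M : Matrix (Fin N) (Fin N) ℤ),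
      zeroLocus F (Ideal.span (instSet G₂ A₂ κ₂ d M)) ∩ torusLocus F N =
        linSlice N F W A κ ∩ cosetU N F ((algebraMap K₂ F) ∘ d) M := by
    intro d hd M
    rw [zeroLocus_instSet_inter_torusLocus F G₂ A₂ κ₂ hd M, hWK₂, hA₂F, hκ₂F]
  -- polynomials of the instance vanish on `X`, hence lie in `P₂`
  have hmemP₂ : ∀ p ∈ instSet G₂ A₂ κ₂ c₂ MJ, p ∈ P₂ := by
    intro p hp
    refine (forall_aeval_eq_zero_iff_mem (Ω := F) P₂ hY₂ p).1 fun z hz => ?_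
    have hzX : z ∈ X := by rw [hX₂]; exact hz
    have hz' : z ∈ zeroLocus F (Ideal.span (instSet G₂ A₂ κ₂ c₂ MJ)) ∩ torusLocus F N := by
      rw [hinstF hc₂' MJ, hc₂F]; exact hXS hzX
    rw [zeroLocus_span] at hz'
    exact hz'.1 p hp
  -- Step 4: the instance over `K₂`
  have hsub₂ : zeroLocus K₂ P₂ ∩ torusLocus K₂ N ⊆
      linSlice N K₂ (zeroLocus K₂ (Ideal.span G₂)) A₂ κ₂ ∩ cosetU N K₂ c₂ MJ := by
    rw [← zeroLocus_instSet_inter_torusLocus_self G₂ A₂ κ₂ hc₂' MJ]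
    rintro z hz
    refine ⟨?_, hz.2⟩
    rw [zeroLocus_span]
    intro p hp
    exact (forall_aeval_eq_zero_iff_mem (Ω := K₂) P₂ hY₂ p).2 (hmemP₂ p hp) z hz
  have hdimX : zariskiDim F X = zariskiDim K₂ (zeroLocus K₂ P₂ ∩ torusLocus K₂ N) := by
    rw [hX₂, zariskiDim_baseChange_inter_torusLocus_of_isPrime (Ω := F) P₂ hY₂,
      zariskiDim_baseChange_inter_torusLocus_of_isPrime (Ω := K₂) P₂ hY₂]
  have hdimslice : zariskiDim F (linSlice N F W A κ) =
      zariskiDim K₂ (linSlice N K₂ (zeroLocus K₂ (Ideal.span G₂)) A₂ κ₂) := by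
    rw [← hsliceF, ← zeroLocus_sliceSet_inter_torusLocus_self G₂ A₂ κ₂]
    exact zariskiDim_baseChange_inter_torusLocus _
  have hatyp₂ : zariskiDim K₂ (linSlice N K₂ (zeroLocus K₂ (Ideal.span G₂)) A₂ κ₂) +
      ((N - (MJ.map (Int.cast : ℤ → ℚ)).rank : ℕ) : WithBot ℕ∞) <
        zariskiDim K₂ (zeroLocus K₂ P₂ ∩ torusLocus K₂ N) + (N : WithBot ℕ∞) := by
    rw [← hdimslice, ← hdimX]; exact hatyp
  have hx₂mem : x₂ ∈ zeroLocus K₂ P₂ ∩ torusLocus K₂ N := by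
    have hxX : x ∈ zeroLocus F P₂ ∩ torusLocus F N := by rw [← hX₂]; exact hx
    rw [← hx₂F] at hxX
    exact ⟨(comp_mem_zeroLocus_iff P₂ x₂).1 hxX.1, (comp_mem_torusLocus_iff x₂).1 hxX.2⟩
  -- descent from `ℂ` to `K₂`
  obtain ⟨MH, hMH, hcont₂, hstar₂⟩ := weakZPBound_descend (Ω := ℂ) G₂ h𝓗₂ A₂ κ₂ MJ hc₂' P₂ hY₂
    hsub₂ hatyp₂ hx₂mem
  refine ⟨MH, hMH, ?_, ?_⟩
  · -- containment, up to `F`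
    intro z hzX
    have hz : z ∈ zeroLocus F P₂ ∩ torusLocus F N := by rw [← hX₂]; exact hzX
    refine ⟨hz.2, fun m hm => ?_⟩
    have hb : cosetBinomial (x₂ ∘ Sum.inr) m ∈ P₂ := by
      refine (forall_aeval_eq_zero_iff_mem (Ω := K₂) P₂ hY₂ _).1 fun w hw => ?_
      have := (aeval_cosetBinomial_eq_zero_iff (E := K₂) hx₂' hw.2 m).2
      refine this ?_
      have h1 := (hcont₂ hw).2 m hm
      simpa using h1
    have h0 : aeval z (cosetBinomial (x₂ ∘ Sum.inr) m) = 0 :=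
      (forall_aeval_eq_zero_iff_mem (Ω := F) P₂ hY₂ _).2 hb z hz
    have h1 := (aeval_cosetBinomial_eq_zero_iff (E := F) hx₂' hz.2 m).1 h0
    exact h1
  · -- `(*)`, up to `F`
    have hdim' : zariskiDim F (linSlice N F W A κ ∩ cosetU N F (x ∘ Sum.inr) MH) =
        zariskiDim K₂ (linSlice N K₂ (zeroLocus K₂ (Ideal.span G₂)) A₂ κ₂ ∩ cosetU N K₂ (x₂ ∘ Sum.inr) MH) := by
      rw [← hx₂F', ← hinstF hx₂' MH, ← zeroLocus_instSet_inter_torusLocus_self G₂ A₂ κ₂ hx₂' MH]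
      exact zariskiDim_baseChange_inter_torusLocus _
    rw [hdimX, hdim']
    exact hstar₂

end Literature.NumberTheory.Transcendental

/-! ### The named fact -/

namespace Literature.NumberTheory.Transcendental

/-- **Bays–Kirby 2018, Prop. 11.5** — the named fact
`Literature.NumberTheory.Transcendental.BaysKirby2018_prop_11_5` (GΓC over `K` ⟹ GSΓC over `K`,
for full Γ-fields `F` and Γ-closed `K ◁_cl F`, exponential case) **holds**: by
`BaysKirby2018_prop_11_5_of_weakZP` (the reduction to the horizontal weak Zilber–Pink bound,
`ZilberProp115.lean`) and `weakZPBound_of_isAlgClosed` (Bays–Kirby's Thm 11.4 for linear slices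
over every algebraically closed field of characteristic zero, transferred from
`WeakZP.weakZPBound_complex`). [cite: BaysKirby2018ANT, Prop. 11.5, Thm 11.4] -/
theorem BaysKirby2018_prop_11_5_holds : BaysKirby2018_prop_11_5 :=
  BaysKirby2018_prop_11_5_of_weakZP fun hF N W hW => weakZPBound_of_isAlgClosed hF N W hW

end Literature.NumberTheory.Transcendental
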